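import Summits.AtomisticToContinuum.Crystallization.Theorems.FrustratedLawDichotomyFiniteClusterGapPrelude

/-!
# FrustratedLawDichotomy · crux `AperiodicFrustratedLawGap` (stmt-AtomisticToContinuum-27623) — the finite class carries NEAR-minimisers:
# the finite-cluster gap has no uniform margin (decomp-a2c, prover hand 2, structural share; tightness of the finite/infinite cut)

`exists_finiteCluster_law_lt`: there is `δ > 0` such that for every `ε > 0` some point-stationary probability law `P` almost surely carried by
FINITE rooted `δ`-hard-core configurations of `ℝ³` has `∫ rootEnergy V_LJ dP < e⋆ + ε`.  So the strict gap of the finite class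
(`eStar_lt_integral_rootEnergy_of_ae_finite`) has infimum exactly `e⋆`: the finite class is settled law by law, not uniformly, and no
compactness argument on finite clusters reaches the infinite-configuration core of the crux — minimising sequences of finite-cluster laws
escape to infinite configurations.

The laws are the UNIFORMLY ROOTED EMPIRICAL LAWS `P_N = N⁻¹ Σᵢ δ_{count|{x_k − x_i}}` of Lennard-Jones ground states `x^N` (existence and the
uniform minimal distance are the proved Literature facts `LennardJonesGroundStatesExist_holds`, `LennardJonesMinimalDistance_holds`):
`P_N` is point-stationary (exact finite mass transport: both sides of the Mecke identity are the double sum `N⁻¹ Σᵢ Σ_k g(x seen from xᵢ, x_k − xᵢ)`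
after the reindexing `θ_{x_k − x_i}(x seen from xᵢ) = x seen from x_k`), and `E_{P_N}[rootEnergy] = E(N)/N → e⋆`
(`sum_rootEnergy_rooted_lennardJones`, `ChargedEnergyGapNegative.crysEnergyLimit`).  The Giry σ-algebra separates finite counting measures
(`measurableSet_singleton_count_restrict`), which makes Dirac masses at configurations computable.  All `[folklore]`.
-/

noncomputable section

namespace Summit.AtomisticToContinuum.Crystallization.Theorems.FrustratedLawDichotomyFiniteClusterGap

open MeasureTheory Metric Set Filter ProbabilityTheory
open scoped ENNReal Topology BigOperators
open Literature.MathematicalPhysics.StatisticalMechanics Literature.Probability.Process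
open Summit.AtomisticToContinuum.Crystallization.Theorems.ChargedEnergyGapNegative (E3 eStar crysEnergyLimit)

/-! ## §1. Dirac masses at finite counting measures -/

section Dirac

/-- **The Giry σ-algebra separates finite counting measures**: `{count|S}` is measurable for finite `S ⊂ ℝ³`
(cut out by `ν Sᶜ = 0` and the finitely many evaluations `ν {s} = 1`, `s ∈ S`). [folklore] -/
theorem measurableSet_singleton_count_restrict {S : Set E3} (hS : S.Finite) :
    MeasurableSet ({(Measure.count : Measure E3).restrict S} : Set (Measure E3)) := by
  classical
  have hSm : MeasurableSet S := hS.measurableSet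
  have hrepr : ({(Measure.count : Measure E3).restrict S} : Set (Measure E3)) =
      {ν : Measure E3 | ν Sᶜ = 0} ∩ ⋂ s ∈ hS.toFinset, {ν : Measure E3 | ν {s} = 1} := by
    ext ν
    simp only [mem_singleton_iff, mem_inter_iff, mem_setOf_eq, mem_iInter, Finite.mem_toFinset]
    constructor
    · rintro rfl
      refine ⟨?_, fun s hs => ?_⟩
      · rw [Measure.restrict_apply hSm.compl, compl_inter_self, measure_empty]
      · rw [Measure.restrict_apply (measurableSet_singleton s), inter_eq_left.2 (singleton_subset_iff.2 hs),
          Measure.count_singleton]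
    · rintro ⟨hc, h1⟩
      obtain ⟨T₀, hT₀⟩ := hS.exists_finset_coe
      subst hT₀
      have hν : ν.restrict (↑T₀ : Set E3) = ν := Measure.restrict_eq_self_of_ae_mem (by rw [ae_iff]; exact hc)
      rw [← hν]
      have key : ∀ T : Finset E3, (∀ s ∈ T, ν {s} = 1) →
          ν.restrict (↑T : Set E3) = (Measure.count : Measure E3).restrict ↑T := by
        intro T hT
        induction T using Finset.induction_on with
        | empty => simp
        | insert a T ha ih =>
          rw [Finset.coe_insert, Set.insert_eq,
            Measure.restrict_union (disjoint_singleton_left.2 (by exact_mod_cast ha)) T.measurableSet,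
            Measure.restrict_union (disjoint_singleton_left.2 (by exact_mod_cast ha)) T.measurableSet,
            ih fun s hs => hT s (Finset.mem_insert_of_mem hs), Measure.restrict_singleton, Measure.restrict_singleton,
            Measure.count_singleton, hT a (Finset.mem_insert_self a T)]
      exact key _ fun s hs => h1 s (Finset.mem_coe.2 hs)
  rw [hrepr]
  refine ((Measure.measurable_coe hSm.compl) (measurableSet_singleton 0)).inter ?_
  exact Finset.measurableSet_biInter _ fun s _ => (Measure.measurable_coe (measurableSet_singleton s)) (measurableSet_singleton 1)

variable {a : Measure E3}

/-- Under a Dirac mass at a separated point every function is a.e. constant. [folklore] -/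
theorem ae_eq_const_dirac_of_measurableSet_singleton (ha : MeasurableSet ({a} : Set (Measure E3))) {β : Type*} (f : Measure E3 → β) :
    f =ᵐ[Measure.dirac a] fun _ => f a := by
  have h : (Measure.dirac a) ({a}ᶜ : Set (Measure E3)) = 0 := by
    rw [Measure.dirac_apply' _ ha.compl]; simp
  refine measure_mono_null (fun ν hν => ?_) h
  intro hνa
  exact hν (show f ν = f a by rw [mem_singleton_iff.1 hνa])

/-- `∫⁻ f dδ_a = f a` for every `f` once `{a}` is measurable. [folklore] -/
theorem lintegral_dirac_of_measurableSet_singleton (ha : MeasurableSet ({a} : Set (Measure E3))) (f : Measure E3 → ℝ≥0∞) :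
    ∫⁻ ν, f ν ∂(Measure.dirac a) = f a := by
  rw [lintegral_congr_ae (ae_eq_const_dirac_of_measurableSet_singleton ha f), lintegral_const, measure_univ, mul_one]

/-- `∫ f dδ_a = f a` for every real `f` once `{a}` is measurable. [folklore] -/
theorem integral_dirac_of_measurableSet_singleton (ha : MeasurableSet ({a} : Set (Measure E3))) (f : Measure E3 → ℝ) :
    ∫ ν, f ν ∂(Measure.dirac a) = f a := by
  rw [integral_congr_ae (ae_eq_const_dirac_of_measurableSet_singleton ha f), integral_const, probReal_univ, one_smul]

/-- A property holding at `a` holds `δ_a`-almost everywhere once `{a}` is measurable. [folklore] -/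
theorem ae_dirac_of_measurableSet_singleton (ha : MeasurableSet ({a} : Set (Measure E3))) {p : Measure E3 → Prop} (hp : p a) :
    ∀ᵐ ν ∂(Measure.dirac a), p ν :=
  (ae_eq_const_dirac_of_measurableSet_singleton ha p).mono fun ν hν => by rw [hν]; exact hp

end Dirac

/-! ## §2. The uniformly rooted empirical law of a finite configuration -/

section Empirical

variable {N : ℕ} {x : Fin N → E3}

/-! Notation of the docstrings: `x seen from xᵢ` is `count|{x_k − x_i | k}`, and the uniformly rooted empirical law is
`P_N = N⁻¹ Σᵢ δ_{x seen from xᵢ}` (both written out in full in the statements; no definitions are introduced). -/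

/-- The rooted configurations are finite counting measures, hence separated by the Giry σ-algebra. [folklore] -/
theorem measurableSet_singleton_rooted (i : Fin N) : MeasurableSet ({((Measure.count : Measure E3).restrict (Set.range fun k => x k - x i))} : Set (Measure E3)) :=
  measurableSet_singleton_count_restrict (Set.finite_range _)

/-- Sums over the configuration seen from `xᵢ`: `∫⁻ f d(count|{x_k − x_i}) = Σ_k f(x_k − x_i)` (distinct points). [folklore] -/
theorem lintegral_rooted (hx : Function.Injective x) (i : Fin N) (f : E3 → ℝ≥0∞) :
    ∫⁻ y, f y ∂((Measure.count : Measure E3).restrict (Set.range fun k => x k - x i)) = ∑ k, f (x k - x i) := by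
  have hinj : Function.Injective fun k => x k - x i := fun k l h => hx (sub_left_inj.1 h)
  rw [range_sub_eq_coe_image, count_restrict_coe_finset, lintegral_finsetSum_measure]
  simp_rw [lintegral_dirac]
  rw [Finset.sum_image fun k _ l _ h => hinj h]

/-- Re-rooting the configuration seen from `xᵢ` at its point `x_k − x_i` gives the configuration seen from `x_k`. [folklore] -/
theorem map_sub_rooted (i k : Fin N) :
    ((Measure.count : Measure E3).restrict (Set.range fun k => x k - x i)).map (fun z => z - (x k - x i)) = ((Measure.count : Measure E3).restrict (Set.range fun m => x m - x k)) := by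
  rw [map_sub_count_restrict]
  congr 1
  ext z
  simp only [mem_image, mem_range]
  constructor
  · rintro ⟨_, ⟨m, rfl⟩, rfl⟩
    exact ⟨m, by abel⟩
  · rintro ⟨m, rfl⟩
    exact ⟨x m - x i, ⟨m, rfl⟩, by abel⟩

/-- Expectations under the empirical law (`ℝ≥0∞`-valued, any integrand). [folklore] -/
theorem lintegral_empiricalLaw (F : Measure E3 → ℝ≥0∞) :
    ∫⁻ ν, F ν ∂((((N : ℕ) : ℝ≥0∞)⁻¹ • ∑ i : Fin N, Measure.dirac ((Measure.count : Measure E3).restrict (Set.range fun k => x k - x i))) : Measure (Measure E3)) = ((N : ℕ) : ℝ≥0∞)⁻¹ * ∑ i, F ((Measure.count : Measure E3).restrict (Set.range fun k => x k - x i)) := by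
  rw [lintegral_smul_measure, lintegral_finsetSum_measure]
  congr 1
  exact Finset.sum_congr rfl fun i _ => lintegral_dirac_of_measurableSet_singleton (measurableSet_singleton_rooted i) F

/-- Expectations under the empirical law (real-valued, any integrand). [folklore] -/
theorem integral_empiricalLaw (F : Measure E3 → ℝ) :
    ∫ ν, F ν ∂((((N : ℕ) : ℝ≥0∞)⁻¹ • ∑ i : Fin N, Measure.dirac ((Measure.count : Measure E3).restrict (Set.range fun k => x k - x i))) : Measure (Measure E3)) = ((N : ℕ) : ℝ)⁻¹ * ∑ i, F ((Measure.count : Measure E3).restrict (Set.range fun k => x k - x i)) := by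
  rw [integral_smul_measure,
    integral_finsetSum_measure fun i _ => (integrable_const (F ((Measure.count : Measure E3).restrict (Set.range fun k => x k - x i)))).congr
      (ae_eq_const_dirac_of_measurableSet_singleton (measurableSet_singleton_rooted i) F).symm]
  rw [smul_eq_mul, ENNReal.toReal_inv, ENNReal.toReal_natCast]
  congr 1
  exact Finset.sum_congr rfl fun i _ => integral_dirac_of_measurableSet_singleton (measurableSet_singleton_rooted i) F

/-- Almost sure properties of the empirical law are properties of every rooted configuration. [folklore] -/
theorem ae_empiricalLaw {p : Measure E3 → Prop} (hp : ∀ i, p ((Measure.count : Measure E3).restrict (Set.range fun k => x k - x i))) : ∀ᵐ ν ∂((((N : ℕ) : ℝ≥0∞)⁻¹ • ∑ i : Fin N, Measure.dirac ((Measure.count : Measure E3).restrict (Set.range fun k => x k - x i))) : Measure (Measure E3)), p ν := by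
  refine Measure.ae_smul_measure ?_ _
  rw [ae_iff, Measure.coe_finsetSum, Finset.sum_apply, Finset.sum_eq_zero]
  intro i _
  exact ae_iff.1 (ae_dirac_of_measurableSet_singleton (measurableSet_singleton_rooted i) (hp i))

/-- The empirical law of `N ≥ 1` particles is a probability law. [folklore] -/
theorem isProbabilityMeasure_empiricalLaw (hN : 0 < N) : IsProbabilityMeasure ((((N : ℕ) : ℝ≥0∞)⁻¹ • ∑ i : Fin N, Measure.dirac ((Measure.count : Measure E3).restrict (Set.range fun k => x k - x i))) : Measure (Measure E3)) := by
  constructor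
  rw [Measure.smul_apply, Measure.coe_finsetSum, Finset.sum_apply]
  simp only [measure_univ, Finset.sum_const, Finset.card_univ, Fintype.card_fin, nsmul_eq_mul, mul_one, smul_eq_mul]
  exact ENNReal.inv_mul_cancel (by exact_mod_cast hN.ne') (ENNReal.natCast_ne_top N)

/-- **Exact finite mass transport**: the uniformly rooted empirical law of a configuration of distinct points is point-stationary — both
sides of the Mecke identity are `N⁻¹ Σᵢ Σ_k g(x seen from xᵢ, x_k − xᵢ)` (Aldous–Lyons: uniform rooting is unimodular). [folklore] -/
theorem isPointStationaryLaw_empiricalLaw (hx : Function.Injective x) : IsPointStationaryLaw ((((N : ℕ) : ℝ≥0∞)⁻¹ • ∑ i : Fin N, Measure.dirac ((Measure.count : Measure E3).restrict (Set.range fun k => x k - x i))) : Measure (Measure E3)) := by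
  intro g _
  rw [lintegral_empiricalLaw, lintegral_empiricalLaw]
  congr 1
  simp_rw [lintegral_rooted hx, map_sub_rooted]
  rw [Finset.sum_comm]
  refine Finset.sum_congr rfl fun k _ => Finset.sum_congr rfl fun i _ => ?_
  rw [neg_sub]

/-- Every rooted configuration of a `δ`-separated `x` is a rooted `δ`-hard-core configuration. [folklore] -/
theorem isRootedHardCore_rooted {δ : ℝ} (hsep : ∀ i j, i ≠ j → δ ≤ dist (x i) (x j)) (i : Fin N) :
    IsRootedHardCore δ ((Measure.count : Measure E3).restrict (Set.range fun k => x k - x i)) := by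
  refine ⟨Set.range fun k => x k - x i, ⟨i, sub_self _⟩, ?_, rfl⟩
  rintro _ ⟨k, rfl⟩ _ ⟨l, rfl⟩ hkl
  rw [dist_sub_right]
  exact hsep k l fun h => hkl (by rw [h])

/-- Every rooted configuration of `x` has finitely many atoms. [folklore] -/
theorem finite_atoms_rooted (i : Fin N) : {p : E3 | ((Measure.count : Measure E3).restrict (Set.range fun k => x k - x i)) {p} ≠ 0}.Finite := by
  rw [setOf_count_restrict_singleton_ne_zero]
  exact Set.finite_range _

/-- **Exact energy identity** `E_{P_N}[rootEnergy] = 𝓔_N(x)/N` (distinct points; `sum_rootEnergy_rooted_lennardJones`). [folklore] -/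
theorem integral_rootEnergy_empiricalLaw (hx : Function.Injective x) :
    ∫ ν, rootEnergy lennardJones ν ∂((((N : ℕ) : ℝ≥0∞)⁻¹ • ∑ i : Fin N, Measure.dirac ((Measure.count : Measure E3).restrict (Set.range fun k => x k - x i))) : Measure (Measure E3)) = interactionEnergy lennardJones x / N := by
  rw [integral_empiricalLaw, div_eq_inv_mul]
  congr 1
  exact sum_rootEnergy_rooted_lennardJones hx

end Empirical

/-! ## §3. Near-minimisers in the finite class -/

/-- **The finite class carries near-minimisers (no uniform margin in the finite-cluster gap).**  There is `δ > 0` such that for every `ε > 0`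
some point-stationary probability law almost surely carried by FINITE rooted `δ`-hard-core configurations has mean root energy `< e⋆ + ε`:
the uniformly rooted empirical law of a Lennard-Jones ground state with `E(N)/N < e⋆ + ε`. [folklore] -/
theorem exists_finiteCluster_law_lt :
    ∃ δ : ℝ, 0 < δ ∧ ∀ ε : ℝ, 0 < ε → ∃ P : Measure (Measure E3), IsProbabilityMeasure P ∧
      (∀ᵐ μ ∂P, IsRootedHardCore δ μ) ∧ IsPointStationaryLaw P ∧ (∀ᵐ μ ∂P, {p : E3 | μ {p} ≠ 0}.Finite) ∧
      ∫ μ, rootEnergy lennardJones μ ∂P < eStar + ε := by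
  obtain ⟨δ, hδ, hsep⟩ := LennardJonesMinimalDistance_holds
  refine ⟨δ, hδ, fun ε hε => ?_⟩
  -- a particle number with `E(N)/N < e⋆ + ε`
  have hev : ∀ᶠ N : ℕ in atTop, groundStateEnergy lennardJones 3 N / N < eStar + ε :=
    (crysEnergyLimit.eventually (gt_mem_nhds (by linarith : eStar < eStar + ε)))
  obtain ⟨N₀, hN₀⟩ := eventually_atTop.1 hev
  set N := max N₀ 1 with hNdef
  have hN : 0 < N := lt_of_lt_of_le one_pos (le_max_right _ _)
  have hEN : groundStateEnergy lennardJones 3 N / N < eStar + ε := hN₀ N (le_max_left _ _)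
  -- a ground state of `N` particles
  obtain ⟨x, hx⟩ := LennardJonesGroundStatesExist_holds N
  haveI := isProbabilityMeasure_empiricalLaw (x := x) hN
  refine ⟨((((N : ℕ) : ℝ≥0∞)⁻¹ • ∑ i : Fin N, Measure.dirac ((Measure.count : Measure E3).restrict (Set.range fun k => x k - x i))) : Measure (Measure E3)), inferInstance, ae_empiricalLaw (isRootedHardCore_rooted (hsep N x hx)),
    isPointStationaryLaw_empiricalLaw hx.1, ae_empiricalLaw finite_atoms_rooted, ?_⟩
  rw [integral_rootEnergy_empiricalLaw hx.1, hx.2]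
  exact hEN

end Summit.AtomisticToContinuum.Crystallization.Theorems.FrustratedLawDichotomyFiniteClusterGap

end
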